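import Summits.NavierStokesRegularity.NavierStokesRegularity.Theses.AxisymmetricExtremality
import Summits.NavierStokesRegularity.NavierStokesRegularity.Theorems.AxisymmetricExtremalityPFoldToAxisymmetric
import Summits.NavierStokesRegularity.NavierStokesRegularity.Theorems.MinimalDatumPFold.Negative.VacuityAndLoadBearing

/-!
# Route AxisymmetricExtremality — relative strength of the crux `MinimalDatumPFold` (stmt-NavierStokesRegularity-15452)

Kernel-checked bookkeeping for the planners of route `AxisymmetricExtremality` (line leads c3/c4 of the crux,
2026-08-17): over the CURRENT tree the crux `MinimalDatumPFold` (Clay failure at `ν` ⇒ `R_{2π/p}`-equivariant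
Rusin–Šverák minimal blow-up data for unboundedly many `p`) sits exactly between the summit and the summit:

* `NavierStokesRegularity → MinimalDatumPFold` — vacuity: the crux's antecedent is verbatim the failure of
  Clay (A) at `ν` (landed as `MinimalDatumPFold.Negative.cruxBody_of_navierStokesRegularity`, p158786);
* `MinimalDatumPFold → AxisymmetricKatoGlobal → NavierStokesRegularity` — the route's deciding theorem `closes`
  fed with the PROVED sibling crux `PFoldToAxisymmetric` (`axisymmetricExtremality_pFoldToAxisymmetric_proof`).

Hence `AxisymmetricKatoGlobal → (MinimalDatumPFold ↔ NavierStokesRegularity)`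
(`stub_minimalDatumPFoldIffSummitOfAXH`): relative to the route's other open
crux #3 (AX_H, [difficulty: open-problem]) the crux IS Clay (A); and unconditionally
`NavierStokesRegularity ↔ MinimalDatumPFold ∧ (AxisymmetricKatoGlobal ∨ NavierStokesRegularity)`
(`stub_summitIffMinimalDatumPFoldAnd`). Together with the landed equivalences of the three line
residuals with the crux (p150684 Smith fixed point mod Sim, p152445/p152883 symmetric gap closing, p160230/p160392
axisymmetric / p-fold sub-threshold concentration) this is the death certificate of every line tried on the crux:
no residual strictly below the crux exists over the tree, and the crux cannot be refuted short of `¬ Clay (A)`.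

Nothing here is new mathematics; both theorems are two-line compositions of landed results, recorded so that the
ledger (not only the crux workfile `Cruxes/MinimalDatumPFold/RelativeToAXH.lean`) carries them.
References: W. Rusin, V. Šverák, J. Funct. Anal. 260 (2011) = arXiv:0911.0500 (the set `M`) [RusinSverak2011];
route file `Theses/AxisymmetricExtremality.lean` (`closes`, rev 2).
-/

set_option linter.dupNamespace false

namespace Summit.NavierStokesRegularity.NavierStokesRegularity.Theorems

open Summit.NavierStokesRegularity.NavierStokesRegularity.Theses.AxisymmetricExtremality

/-- **Relative to AX_H the crux is the summit.** Assuming the route's crux #3 `AxisymmetricKatoGlobal` (every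
admissible axisymmetric `Ḣ^{1/2}` datum has a global Kato solution), the crux `MinimalDatumPFold` is EQUIVALENT to
the summit statement `NavierStokesRegularity`: (→) is the route's deciding theorem `closes` with the proved sibling
crux `PFoldToAxisymmetric`; (←) is vacuity of the Clay-failure antecedent
(`MinimalDatumPFold.Negative.cruxBody_of_navierStokesRegularity`). So the route's two open cruxes are not a
factorisation of Clay (A) into two easier statements: given either one, the other is at least the summit. [folklore] -/
theorem stub_minimalDatumPFoldIffSummitOfAXH : Summit.NavierStokesRegularity.NavierStokesRegularity.Theses.AxisymmetricExtremality.AxisymmetricKatoGlobal → (Summit.NavierStokesRegularity.NavierStokesRegularity.Theses.AxisymmetricExtremality.MinimalDatumPFold ↔ NavierStokesRegularity) :=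
  fun h₃ => ⟨fun h₂ => closes h₂ axisymmetricExtremality_pFoldToAxisymmetric_proof h₃,
   fun hS => MinimalDatumPFold.Negative.cruxBody_of_navierStokesRegularity hS⟩

/-- **Unconditional form.** `NavierStokesRegularity ↔ MinimalDatumPFold ∧ (AxisymmetricKatoGlobal ∨
NavierStokesRegularity)`: the summit implies the crux (vacuity) and trivially the disjunction; conversely the crux
with AX_H gives the summit through `closes` and the proved `PFoldToAxisymmetric`. (The disjunct `∨
NavierStokesRegularity` is needed: the summit does NOT imply AX_H, which speaks about all axisymmetric `Ḣ^{1/2}`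
data, not only Schwartz-class ones.) [folklore] -/
theorem stub_summitIffMinimalDatumPFoldAnd : NavierStokesRegularity ↔ (Summit.NavierStokesRegularity.NavierStokesRegularity.Theses.AxisymmetricExtremality.MinimalDatumPFold ∧ (Summit.NavierStokesRegularity.NavierStokesRegularity.Theses.AxisymmetricExtremality.AxisymmetricKatoGlobal ∨ NavierStokesRegularity)) :=
  ⟨fun hS => ⟨MinimalDatumPFold.Negative.cruxBody_of_navierStokesRegularity hS, Or.inr hS⟩,
   fun h => h.2.elim (fun h₃ => closes h.1 axisymmetricExtremality_pFoldToAxisymmetric_proof h₃) id⟩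

end Summit.NavierStokesRegularity.NavierStokesRegularity.Theorems
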